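import Literature.MathematicalPhysics.QuantumLattice.TwistedTorusShifts
import Literature.MathematicalPhysics.QuantumLattice.GrassmannIntegralProofs
import HarnessLib

/-!
# The free Wilson–Dirac operator in a constant diagonal `SU(3)` twist has no zero modes

Topic `Literature/MathematicalPhysics/QuantumLattice`; namespace
`Literature.MathematicalPhysics.QuantumLattice` (auxiliary matrices in `TwistedFreeWilson`).

**Result** (`wilsonDirac_twistCfg_det_ne_zero`, `exists_gaugeConfig_wilsonDirac_det_ne_zero`): on
the periodic torus `(ℤ/L)⁴`, `L ≥ 1`, the `r = 1` Wilson–Dirac operator of the tree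
(`wilsonDirac (fundamentalRep (Fin 3)) U m 1`) in the CONSTANT gauge field
`U₀ ≡ g = diag(e^{iθ}, e^{iθ}, e^{-2iθ}) ∈ SU(3)`, `θ = π/(4L)` (`TwistedTorusShifts.lean`), has
non-zero determinant for EVERY real bare mass `m` — whereas the free field `U ≡ 1` has zero modes
at the doubler masses `m ∈ {0, -2, -4, -6, -8}`.  Momentum-space content: the twisted free operator
is `(m + 4 − Σ_μ cos(p_μ + θ_a)) + i Σ_μ γ_μ sin(p_μ + θ_a)` colour by colour, invertible as soon as
`sin(p_0 + θ_a) ≠ 0` for all lattice momenta, i.e. `2Lθ_a ∉ πℤ` (Montvay–Münster 1994 §4.2, free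
Wilson propagator).  The proof stays in position space: with `F_μ = T_μ ⊗ g` the twisted forward
shifts (commuting unitaries), `D_W = (m+4) − Σ_μ (F_μ ⊗ P⁻_μ + F_μᴴ ⊗ P⁺_μ)` and
`2 D_W = A ⊗ 1 − Σ_μ G_μ ⊗ γ_μ`, `A = 2(m+4) − Σ_μ (F_μ + F_μᴴ)` Hermitian, `G_μ = F_μᴴ − F_μ`
skew-Hermitian, all commuting; the Clifford relations give
`(A⊗1 + ΣG_μ⊗γ_μ)(A⊗1 − ΣG_μ⊗γ_μ) = (A⊗1)ᴴ(A⊗1) + Σ_μ (G_μ⊗γ_μ)ᴴ(G_μ⊗γ_μ)`, so `D_W ψ = 0` forces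
`(G_0 ⊗ 1)ψ = 0`, i.e. `(F_0 ⊗ 1)ψ = (F_0ᴴ ⊗ 1)ψ`, hence `(F_0 ⊗ 1)^{2L} ψ = ψ`; but
`F_0^{2L} = 1 ⊗ diag(i, i, −1)` has no eigenvalue `1`, so `ψ = 0`.

**Use**: one configuration with `det ≠ 0` for all masses makes the phase-quenched denominator
`∫ |det D| dμ_W` positive unconditionally (`QuantumFieldTheory/QCDPhaseQuenchedPositivity.lean`).
Origin: lean-checked by a stub worker of crux `PauliWegnerSea.FMClosureUnquenched`
(stmt-QuantumFields-11512, clause (T0) of its two-star bounds), restyled for the Literature tree.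
-/

noncomputable section

open scoped BigOperators Kronecker ComplexOrder
open Matrix Complex
open Literature.MathematicalPhysics.QuantumFieldTheory
open Literature.Probability.LatticeModels (TorusSite)

namespace Literature.MathematicalPhysics.QuantumLattice

/-! ### Kronecker bookkeeping -/

section KroneckerHelpers

variable {m n : Type*}

/-- `(A₁ - A₂) ⊗ B = A₁ ⊗ B - A₂ ⊗ B` (local copy of `XYOrderGDProofs.sub_kronecker`). [folklore] -/
private theorem sub_kronecker' (A₁ A₂ : Matrix m m ℂ) (B : Matrix n n ℂ) :
    (A₁ - A₂) ⊗ₖ B = A₁ ⊗ₖ B - A₂ ⊗ₖ B := by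
  ext ⟨i, k⟩ ⟨j, l⟩
  simp [kroneckerMap_apply, sub_mul]

/-- `(-A) ⊗ B = -(A ⊗ B)` (local copy of `LiebFluxPhaseSplit.neg_kronecker`). [folklore] -/
private theorem neg_kronecker' (A : Matrix m m ℂ) (B : Matrix n n ℂ) : (-A) ⊗ₖ B = -(A ⊗ₖ B) := by
  ext ⟨i, j⟩ ⟨i', j'⟩
  simp [kroneckerMap_apply]

/-- `A ⊗ (-B) = -(A ⊗ B)` (local copy of `LiebFluxPhaseSplit.kronecker_neg`). [folklore] -/
private theorem kronecker_neg' (A : Matrix m m ℂ) (B : Matrix n n ℂ) : A ⊗ₖ (-B) = -(A ⊗ₖ B) := by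
  ext ⟨i, j⟩ ⟨i', j'⟩
  simp [kroneckerMap_apply]

/-- `(Σᵢ Aᵢ) ⊗ B = Σᵢ Aᵢ ⊗ B` (local copy of `XYOrderGDProofs.sum_kronecker`). [folklore] -/
private theorem sum_kronecker' {ι : Type*} (s : Finset ι) (A : ι → Matrix m m ℂ) (B : Matrix n n ℂ) :
    (∑ i ∈ s, A i) ⊗ₖ B = ∑ i ∈ s, A i ⊗ₖ B := by
  ext ⟨i, k⟩ ⟨j, l⟩
  simp [kroneckerMap_apply, Matrix.sum_apply, Finset.sum_mul]

/-- `(A ⊗ B)^k = A^k ⊗ B^k`. [folklore] -/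
private theorem kronecker_pow' [Fintype m] [Fintype n] [DecidableEq m] [DecidableEq n]
    (A : Matrix m m ℂ) (B : Matrix n n ℂ) (k : ℕ) : (A ⊗ₖ B) ^ k = (A ^ k) ⊗ₖ (B ^ k) := by
  induction k with
  | zero => simp
  | succ k ih => rw [pow_succ, ih, ← mul_kronecker_mul, ← pow_succ, ← pow_succ]

/-- `(diag 1 ⊗ diag w) ⊗ diag 1` acts diagonally. [folklore] -/
private theorem one_kronecker_diagonal_kronecker_one_mulVec [Fintype m] [DecidableEq m] [Fintype n]
    [DecidableEq n] {k : Type*} [Fintype k] [DecidableEq k] (w : k → ℂ) (ψ : (m × k) × n → ℂ)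
    (x : m) (a : k) (i : n) :
    ((((1 : Matrix m m ℂ) ⊗ₖ Matrix.diagonal w) ⊗ₖ (1 : Matrix n n ℂ)) *ᵥ ψ) ((x, a), i) =
      w a * ψ ((x, a), i) := by
  rw [show (1 : Matrix m m ℂ) = Matrix.diagonal (fun _ => 1) from Matrix.diagonal_one.symm,
    show (1 : Matrix n n ℂ) = Matrix.diagonal (fun _ => 1) from Matrix.diagonal_one.symm,
    diagonal_kronecker_diagonal, diagonal_kronecker_diagonal, mulVec_diagonal]
  simp

end KroneckerHelpers

/-! ### An abstract Clifford factorisation -/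

section Clifford

variable {W : Type*} [Fintype W] [DecidableEq W]

/-- The square of a sum of four pairwise anticommuting matrices is the sum of their squares. [folklore] -/
theorem sum_mul_sum_of_anticomm (Q : Fin 4 → Matrix W W ℂ)
    (h : ∀ μ ν, μ ≠ ν → Q μ * Q ν = -(Q ν * Q μ)) :
    (∑ μ, Q μ) * (∑ μ, Q μ) = ∑ μ, Q μ * Q μ := by
  have h10 := h 1 0 (by decide)
  have h20 := h 2 0 (by decide)
  have h30 := h 3 0 (by decide)
  have h21 := h 2 1 (by decide)
  have h31 := h 3 1 (by decide)
  have h32 := h 3 2 (by decide)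
  simp only [Fin.sum_univ_four, add_mul, mul_add]
  rw [h10, h20, h30, h21, h31, h32]
  abel

/-- `(P + ΣQ)(P − ΣQ) = P² − Σ Q_μ²` when `P` commutes with every `Q_μ` and the `Q_μ` pairwise
anticommute. [folklore] -/
theorem clifford_factor (P : Matrix W W ℂ) (Q : Fin 4 → Matrix W W ℂ)
    (hPQ : ∀ μ, P * Q μ = Q μ * P) (hQQ : ∀ μ ν, μ ≠ ν → Q μ * Q ν = -(Q ν * Q μ)) :
    (P + ∑ μ, Q μ) * (P - ∑ μ, Q μ) = P * P - ∑ μ, Q μ * Q μ := by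
  have hc : Commute P (∑ μ, Q μ) := Commute.sum_right _ _ _ fun μ _ => hPQ μ
  rw [← hc.mul_self_sub_mul_self_eq, sum_mul_sum_of_anticomm Q hQQ]

end Clifford

namespace TwistedFreeWilson

variable (L : ℕ) [NeZero L]

/-! ### The Wilson operator of the twisted field in Kronecker form -/

/-- `A = 2(m+4) − Σ_μ (F_μ + F_μᴴ)`. [folklore] -/
def Amat (m : ℝ) : Matrix (VIdx L) (VIdx L) ℂ :=
  ((2 * (m + 4) : ℝ) : ℂ) • (1 : Matrix (VIdx L) (VIdx L) ℂ) - ∑ μ, (Fmat L μ + (Fmat L μ)ᴴ)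

/-- `G_μ = F_μᴴ − F_μ`. [folklore] -/
def Gmat (μ : Fin 4) : Matrix (VIdx L) (VIdx L) ℂ := (Fmat L μ)ᴴ - Fmat L μ

/-- `P = A ⊗ 1`. [folklore] -/
def Pmat (m : ℝ) : Matrix (VIdx L × Fin 4) (VIdx L × Fin 4) ℂ :=
  Amat L m ⊗ₖ (1 : Matrix (Fin 4) (Fin 4) ℂ)

/-- `Q_μ = G_μ ⊗ γ_μ`. [folklore] -/
def Qmat (μ : Fin 4) : Matrix (VIdx L × Fin 4) (VIdx L × Fin 4) ℂ :=
  Gmat L μ ⊗ₖ euclideanGamma μ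

/-- The Wilson operator of the twisted field in Kronecker coordinates `(site × colour) × spin`. [folklore] -/
def Dk (m : ℝ) : Matrix (VIdx L × Fin 4) (VIdx L × Fin 4) ℂ :=
  ((m + 4 : ℝ) : ℂ) • (1 : Matrix (VIdx L × Fin 4) (VIdx L × Fin 4) ℂ) -
    ∑ μ, (Fmat L μ ⊗ₖ chiralProjMinus μ + (Fmat L μ)ᴴ ⊗ₖ chiralProjPlus μ)

variable {L}

/-- `A` commutes with every `G_μ`. [folklore] -/
theorem Amat_comm_Gmat (m : ℝ) (μ : Fin 4) : Amat L m * Gmat L μ = Gmat L μ * Amat L m := by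
  have h : Commute (Amat L m) (Gmat L μ) := by
    refine Commute.sub_left (Commute.smul_left (Commute.one_left _) _)
      (Commute.sum_left _ _ _ fun ν _ => Commute.add_left (Commute.sub_right ?_ ?_)
        (Commute.sub_right ?_ ?_))
    · exact Fmat_mul_conjTranspose_comm ν μ
    · exact Fmat_comm ν μ
    · show (Fmat L ν)ᴴ * (Fmat L μ)ᴴ = (Fmat L μ)ᴴ * (Fmat L ν)ᴴ
      rw [← conjTranspose_mul, ← conjTranspose_mul, Fmat_comm]
    · exact (Fmat_mul_conjTranspose_comm μ ν).symm
  exact h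

/-- The `G_μ` commute. [folklore] -/
theorem Gmat_comm (μ ν : Fin 4) : Gmat L μ * Gmat L ν = Gmat L ν * Gmat L μ := by
  have h : Commute (Gmat L μ) (Gmat L ν) := by
    refine Commute.sub_left (Commute.sub_right ?_ ?_) (Commute.sub_right ?_ ?_)
    · show (Fmat L μ)ᴴ * (Fmat L ν)ᴴ = (Fmat L ν)ᴴ * (Fmat L μ)ᴴ
      rw [← conjTranspose_mul, ← conjTranspose_mul, Fmat_comm]
    · exact (Fmat_mul_conjTranspose_comm ν μ).symm
    · exact Fmat_mul_conjTranspose_comm μ ν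
    · exact Fmat_comm μ ν
  exact h

/-- `P` commutes with every `Q_μ`. [folklore] -/
theorem Pmat_mul_Qmat (m : ℝ) (μ : Fin 4) : Pmat L m * Qmat L μ = Qmat L μ * Pmat L m := by
  simp only [Pmat, Qmat, ← mul_kronecker_mul, Matrix.one_mul, Matrix.mul_one, Amat_comm_Gmat]

/-- The `Q_μ` pairwise anticommute (Clifford relations of the `γ_μ`, commuting `G_μ`). [folklore] -/
theorem Qmat_anticomm (μ ν : Fin 4) (hμν : μ ≠ ν) : Qmat L μ * Qmat L ν = -(Qmat L ν * Qmat L μ) := by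
  simp only [Qmat, ← mul_kronecker_mul]
  rw [euclideanGamma_mul_of_ne hμν, Gmat_comm μ ν, kronecker_neg']

omit [NeZero L] in
/-- `A` is Hermitian. [folklore] -/
theorem Amat_conjTranspose (m : ℝ) : (Amat L m)ᴴ = Amat L m := by
  simp only [Amat, conjTranspose_sub, conjTranspose_smul, conjTranspose_one, conjTranspose_sum,
    conjTranspose_add, conjTranspose_conjTranspose, Complex.star_def, Complex.conj_ofReal]
  simp only [add_comm]

omit [NeZero L] in
/-- `P` is Hermitian. [folklore] -/
theorem Pmat_conjTranspose (m : ℝ) : (Pmat L m)ᴴ = Pmat L m := by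
  rw [Pmat, conjTranspose_kronecker, conjTranspose_one, Amat_conjTranspose]

omit [NeZero L] in
/-- `Q_μ` is skew-Hermitian. [folklore] -/
theorem Qmat_conjTranspose (μ : Fin 4) : (Qmat L μ)ᴴ = -Qmat L μ := by
  rw [Qmat, conjTranspose_kronecker, (euclideanGamma_isHermitian μ).eq, Gmat, conjTranspose_sub,
    conjTranspose_conjTranspose, ← neg_sub, neg_kronecker']

omit [NeZero L] in
/-- `2 D = P − Σ_μ Q_μ`. [folklore] -/
theorem two_smul_Dk (m : ℝ) : (2 : ℂ) • Dk L m = Pmat L m - ∑ μ, Qmat L μ := by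
  have hK : ∀ μ, (2 : ℂ) • (Fmat L μ ⊗ₖ chiralProjMinus μ + (Fmat L μ)ᴴ ⊗ₖ chiralProjPlus μ) =
      (Fmat L μ + (Fmat L μ)ᴴ) ⊗ₖ (1 : Matrix (Fin 4) (Fin 4) ℂ) + Qmat L μ := fun μ => by
    ext ⟨v, i⟩ ⟨w, j⟩
    simp only [Qmat, Gmat, Matrix.smul_apply, Matrix.add_apply, Matrix.sub_apply,
      Matrix.kroneckerMap_apply, chiralProjMinus, chiralProjPlus, Matrix.one_apply, smul_eq_mul]
    split_ifs <;> ring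
  have hc : (2 : ℂ) • ((((m + 4 : ℝ) : ℂ)) • (1 : Matrix (VIdx L × Fin 4) (VIdx L × Fin 4) ℂ)) =
      (((2 * (m + 4) : ℝ)) : ℂ) • ((1 : Matrix (VIdx L) (VIdx L) ℂ) ⊗ₖ (1 : Matrix (Fin 4) (Fin 4) ℂ)) := by
    rw [smul_smul, one_kronecker_one]
    push_cast
    rfl
  unfold Dk
  rw [smul_sub, Finset.smul_sum]
  simp only [hK]
  rw [Finset.sum_add_distrib, hc, Pmat, Amat, sub_kronecker', smul_kronecker, sum_kronecker']
  abel

/-- Reindexing commutes with `c • 1 − Σ`. [folklore] -/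
theorem reindex_smul_one_sub_sum {M N : Type*} [DecidableEq M] [DecidableEq N]
    (e : M ≃ N) (c : ℂ) (X : Fin 4 → Matrix M M ℂ) :
    Matrix.reindex e e (c • (1 : Matrix M M ℂ) - ∑ μ, X μ) =
      c • (1 : Matrix N N ℂ) - ∑ μ, Matrix.reindex e e (X μ) := by
  ext p q
  simp only [Matrix.reindex_apply, Matrix.submatrix_apply, Matrix.sub_apply, Matrix.smul_apply,
    Matrix.sum_apply, Matrix.one_apply, e.symm.injective.eq_iff]

omit [NeZero L] in
/-- The Wilson operator of the twisted field is the reindexed `Dk`. [folklore] -/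
theorem wilsonDirac_twistCfg (m : ℝ) :
    wilsonDirac (fundamentalRep (Fin 3)) (twistCfg L) m 1 =
      Matrix.reindex (Equiv.prodAssoc _ _ _) (Equiv.prodAssoc _ _ _) (Dk L m) := by
  rw [wilsonDirac_eq_sub_sum_wilsonHop (fundamentalRep (Fin 3)) fundamentalRep_mem_unitaryGroup,
    Dk, reindex_smul_one_sub_sum]
  simp only [wilsonHop, linkHop_twistCfg]

/-- **The twisted free Wilson operator is injective at every real mass.** [folklore] -/
theorem Dk_mulVec_eq_zero_imp (m : ℝ) (ψ : VIdx L × Fin 4 → ℂ) (hψ : Dk L m *ᵥ ψ = 0) : ψ = 0 := by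
  have hPQ : ∀ μ, Pmat L m * Qmat L μ = Qmat L μ * Pmat L m := Pmat_mul_Qmat m
  have hQQ : ∀ μ ν, μ ≠ ν → Qmat L μ * Qmat L ν = -(Qmat L ν * Qmat L μ) := Qmat_anticomm
  -- `(P − ΣQ) ψ = 0`
  have h1 : (Pmat L m - ∑ μ, Qmat L μ) *ᵥ ψ = 0 := by
    rw [← two_smul_Dk, Matrix.smul_mulVec, hψ, smul_zero]
  -- `(P² − Σ Q²) ψ = 0`
  have h2 : (Pmat L m * Pmat L m - ∑ μ, Qmat L μ * Qmat L μ) *ᵥ ψ = 0 := by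
    rw [← clifford_factor _ _ hPQ hQQ, ← Matrix.mulVec_mulVec, h1, Matrix.mulVec_zero]
  -- the quadratic form `‖Pψ‖² + Σ ‖Q_μ ψ‖² = 0`
  have h3 : star (Pmat L m *ᵥ ψ) ⬝ᵥ (Pmat L m *ᵥ ψ) +
      ∑ μ, star (Qmat L μ *ᵥ ψ) ⬝ᵥ (Qmat L μ *ᵥ ψ) = 0 := by
    have h := congrArg (fun w => star ψ ⬝ᵥ w) h2
    simp only [dotProduct_zero, Matrix.sub_mulVec, Matrix.sum_mulVec, ← Matrix.mulVec_mulVec] at h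
    rw [dotProduct_sub, dotProduct_sum] at h
    have hPh : star ψ ᵥ* Pmat L m = star (Pmat L m *ᵥ ψ) := by
      rw [Matrix.star_mulVec, Pmat_conjTranspose]
    have hQh : ∀ μ, star ψ ᵥ* Qmat L μ = -star (Qmat L μ *ᵥ ψ) := fun μ => by
      rw [Matrix.star_mulVec, Qmat_conjTranspose, Matrix.vecMul_neg, neg_neg]
    have hPterm : star ψ ⬝ᵥ (Pmat L m *ᵥ (Pmat L m *ᵥ ψ)) =
        star (Pmat L m *ᵥ ψ) ⬝ᵥ (Pmat L m *ᵥ ψ) := by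
      rw [Matrix.dotProduct_mulVec, hPh]
    have hQterm : ∀ μ, star ψ ⬝ᵥ (Qmat L μ *ᵥ (Qmat L μ *ᵥ ψ)) =
        -(star (Qmat L μ *ᵥ ψ) ⬝ᵥ (Qmat L μ *ᵥ ψ)) := fun μ => by
      rw [Matrix.dotProduct_mulVec, hQh, neg_dotProduct]
    simp only [hPterm, hQterm, Finset.sum_neg_distrib, sub_neg_eq_add] at h
    exact h
  have hnonneg : ∀ μ, 0 ≤ star (Qmat L μ *ᵥ ψ) ⬝ᵥ (Qmat L μ *ᵥ ψ) := fun μ =>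
    dotProduct_star_self_nonneg _
  have h4 : star (Qmat L 0 *ᵥ ψ) ⬝ᵥ (Qmat L 0 *ᵥ ψ) = 0 := by
    have hs0 : 0 ≤ ∑ μ, star (Qmat L μ *ᵥ ψ) ⬝ᵥ (Qmat L μ *ᵥ ψ) :=
      Finset.sum_nonneg fun μ _ => hnonneg μ
    have hp0 : 0 ≤ star (Pmat L m *ᵥ ψ) ⬝ᵥ (Pmat L m *ᵥ ψ) := dotProduct_star_self_nonneg _
    have hsum := ((add_eq_zero_iff_of_nonneg hp0 hs0).1 h3).2
    exact (Finset.sum_eq_zero_iff_of_nonneg (fun μ _ => hnonneg μ)).1 hsum 0 (Finset.mem_univ _)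
  have h5 : Qmat L 0 *ᵥ ψ = 0 := dotProduct_star_self_eq_zero.1 h4
  -- `(G_0 ⊗ 1) ψ = 0`
  have h6 : (Gmat L 0 ⊗ₖ (1 : Matrix (Fin 4) (Fin 4) ℂ)) *ᵥ ψ = 0 := by
    have : ((1 : Matrix (VIdx L) (VIdx L) ℂ) ⊗ₖ euclideanGamma 0) * Qmat L 0 =
        Gmat L 0 ⊗ₖ (1 : Matrix (Fin 4) (Fin 4) ℂ) := by
      rw [Qmat, ← mul_kronecker_mul, Matrix.one_mul, euclideanGamma_mul_self]
    rw [← this, ← Matrix.mulVec_mulVec, h5, Matrix.mulVec_zero]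
  -- `N ψ = Nᴴ ψ`, `N = F_0 ⊗ 1` unitary, hence `N² ψ = ψ`
  set N : Matrix (VIdx L × Fin 4) (VIdx L × Fin 4) ℂ :=
    Fmat L 0 ⊗ₖ (1 : Matrix (Fin 4) (Fin 4) ℂ) with hN
  have h7 : N *ᵥ ψ = Nᴴ *ᵥ ψ := by
    have : Gmat L 0 ⊗ₖ (1 : Matrix (Fin 4) (Fin 4) ℂ) = Nᴴ - N := by
      rw [hN, Gmat, sub_kronecker', conjTranspose_kronecker, conjTranspose_one]
    rw [this, Matrix.sub_mulVec, sub_eq_zero] at h6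
    exact h6.symm
  have hNN : N * Nᴴ = 1 := by
    rw [hN, conjTranspose_kronecker, conjTranspose_one, ← mul_kronecker_mul, Matrix.mul_one,
      Fmat_mul_conjTranspose_self, one_kronecker_one]
  have h8 : (N * N) *ᵥ ψ = ψ := by
    rw [← Matrix.mulVec_mulVec, h7, Matrix.mulVec_mulVec, hNN, Matrix.one_mulVec]
  have h9 : ∀ k : ℕ, ((N * N) ^ k) *ᵥ ψ = ψ := by
    intro k
    induction k with
    | zero => simp
    | succ k ih => rw [pow_succ, ← Matrix.mulVec_mulVec, h8, ih]
  -- `(N N)^L = (1 ⊗ g^{2L}) ⊗ 1`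
  have hpow : (N * N) ^ L =
      ((1 : Matrix (TorusSite 4 L) (TorusSite 4 L) ℂ) ⊗ₖ
          Matrix.diagonal (fun a => twistDiag L a ^ (2 * L))) ⊗ₖ (1 : Matrix (Fin 4) (Fin 4) ℂ) := by
    rw [← sq, ← pow_mul, hN, kronecker_pow', one_pow, Fmat, kronecker_pow', mul_comm 2 L, pow_mul,
      torusShiftMat_pow_self, one_pow, ← mul_comm 2 L, diagonal_pow]
    rfl
  have h10 := h9 L
  rw [hpow] at h10
  funext p
  obtain ⟨⟨x, a⟩, i⟩ := p
  have hp := congrFun h10 ((x, a), i)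
  rw [one_kronecker_diagonal_kronecker_one_mulVec] at hp
  have hz : (twistDiag L a ^ (2 * L) - 1) * ψ ((x, a), i) = 0 := by
    rw [sub_mul, one_mul, hp, sub_self]
  rcases mul_eq_zero.1 hz with h | h
  · exact absurd (sub_eq_zero.1 h) (twistDiag_pow_ne_one a)
  · simpa using h

end TwistedFreeWilson

open TwistedFreeWilson in
/-- **The Wilson–Dirac operator of the constant twisted `SU(3)` field `U₀ ≡ diag(e^{iπ/4L},
e^{iπ/4L}, e^{-iπ/2L})` has non-zero determinant at every real bare mass**, on every periodic
torus `(ℤ/L)⁴`, `L ≥ 1` (Montvay–Münster 1994 §4.2: the free Wilson propagator is singular only at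
momenta with all `sin p_μ = 0`; the colour twist shifts the momenta off that set). [folklore] -/
theorem wilsonDirac_twistCfg_det_ne_zero {L : ℕ} [NeZero L] (m : ℝ) :
    (wilsonDirac (fundamentalRep (Fin 3)) (twistCfg L) m 1).det ≠ 0 := by
  rw [wilsonDirac_twistCfg, Matrix.det_reindex_self]
  intro hdet
  obtain ⟨v, hv, hDv⟩ := Matrix.exists_mulVec_eq_zero_iff.2 hdet
  exact hv (Dk_mulVec_eq_zero_imp m v hDv)

/-- **Some `SU(3)` gauge field has `det D_W ≠ 0` at every real bare mass**, on every periodic torus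
(existential form; the input of `integral_norm_det_diracMatrix_pos_of_exists`). [folklore] -/
theorem exists_gaugeConfig_wilsonDirac_det_ne_zero (L : ℕ) [NeZero L] :
    ∃ U₀ : GaugeConfig 4 L (Matrix.specialUnitaryGroup (Fin 3) ℂ),
      ∀ m : ℝ, (wilsonDirac (fundamentalRep (Fin 3)) U₀ m 1).det ≠ 0 :=
  ⟨TwistedFreeWilson.twistCfg L, wilsonDirac_twistCfg_det_ne_zero⟩

end Literature.MathematicalPhysics.QuantumLattice

end
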